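import Summits.QuantumFields.YangMills.Theorems.WeakCouplingRatesColdBoxPlaqVariance
import Summits.QuantumFields.YangMills.Theorems.WeakCouplingRatesColdBoxDirichletForm
import Summits.QuantumFields.YangMills.Theorems.WeakCouplingRatesColdBoxLargeFieldSU2
import Literature.Probability.Distributions.GaussianVectorMaxTail

/-!
# Crux `BulkDominatesColdBoxW` (stmt-QuantumFields-19609), stubs L1a/L1b, and crux `ColdBoxTwoPointFloorW` S3c: the GAUSSIAN
# large-field bound of the temporal-gauge Dirichlet box Gaussian D1'

Brick R5 of the one-scale assembly (PLAN-S3c-ii addendum 3, fleet seat `ym-wcr-19456-p1`; census v3 of the line `dlr-chessboard` of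
19609, brick table §4, input of the interface `KernelMeanExpansion`): under `boxDirichlet H` every circulation `s(p)` of a plaquette
touching the cold box is a centred Gaussian of variance `≤ 1` (`integral_dirCirc_sq_le_one`), so the Gaussian mass of the complement of
the small-field region `{∀ p, |s(p)| ≤ R}` is at most `2·#{p touching}·e^{−R²/2} ≤ 240(2H+1)⁴e^{−R²/2}`.  Assembled from the tree's
maximal inequality for linear functionals of `N(0,S)` (`Literature.Probability.Distributions.measureReal_exists_abs_dotProduct_ge_le`),
`boxDirichlet H = N(0, Q_D⁻¹)` (`LatticeMaxwell.τ`), `s(p) = λ_p · s` (`sCirc_glue_zero_eq_sum`) and `λ_pᵀQ_D⁻¹λ_p ≤ 1`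
(`dotProduct_coeff_inv_mulVec_coeff_le_one`, `posDef_dirQmat`).

* `measureReal_boxDirichlet_abs_dirCirc_ge_le` — one plaquette: `D{ R ≤ |s(p)| } ≤ 2e^{−R²/2}`;
* `measureReal_boxDirichlet_exists_abs_dirCirc_ge_le` — **`D{∃ p touching Λ_H, R ≤ |s(p)|} ≤ 2·#(plaquettesTouching Λ_H)·e^{−R²/2}`**;
* `measureReal_boxDirichlet_not_smallField_le` — complement form over ALL plaquettes of `ℤ⁴` (non-touching circulations vanish):
  `D{¬ ∀ p, |s(p)| ≤ R} ≤ 240(2H+1)⁴e^{−R²/2}`.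

Fleet seat `ym-spine-20043-p1` (g3, re-targeted to R2ξ by director-ym LINE №76/№78; line lead `ym-wcr-19609-p1`).  No sorry, standard axioms,
no new definition, no named-fact hypothesis.  NOT a claim about the mass gap: a statement about a finite-dimensional Gaussian.
-/

set_option autoImplicit false

noncomputable section

open MeasureTheory ProbabilityTheory Finset Matrix Real
open scoped NNReal
open Literature.Probability.LatticeModels
open Literature.MathematicalPhysics.QuantumLattice
open Literature.MathematicalPhysics.QuantumFieldTheory
open Literature.MathematicalPhysics.QuantumFieldTheory.LatticeMaxwell
open Literature.MathematicalPhysics.QuantumFieldTheory.AxialGauge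

namespace Summit.QuantumFields.YangMills.Theorems.WeakCouplingRates

variable {H : ℕ}

/-- The covariance `Q_D⁻¹` of D1' is positive semidefinite. -/
theorem posSemidef_dirQmat_inv (H : ℕ) :
    ((Qmat (fun e => e ∉ dirFreeEdges H) dirCorner (2 * H + 3))⁻¹).PosSemidef :=
  (posDef_dirQmat H).inv.posSemidef

/-- A Dirichlet circulation is the linear functional `s ↦ Σ_e λ_p(e) s_e`. -/
theorem dirCirc_eq_sum (p : Plaq 4) (s : EuclideanSpace ℝ (DirFree H)) :
    dirCirc H p s = ∑ e : DirFree H, coeff (fun e => e ∉ dirFreeEdges H) dirCorner (2 * H + 3) p e * s e :=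
  sCirc_glue_zero_eq_sum p s

/-- The variance vector of a touching plaquette: `λ_pᵀ Q_D⁻¹ λ_p ≤ 1`. -/
theorem coeff_inv_mulVec_coeff_le_one_of_touching {p : ZdPlaquette 4}
    (hp : p ∈ plaquettesTouching (boxEdges 4 (2 * H + 1))) :
    coeff (fun e => e ∉ dirFreeEdges H) dirCorner (2 * H + 3) ((p.1, p.2.1.1, p.2.1.2) : Plaq 4) ⬝ᵥ
        (Qmat (fun e => e ∉ dirFreeEdges H) dirCorner (2 * H + 3))⁻¹ *ᵥ
          coeff (fun e => e ∉ dirFreeEdges H) dirCorner (2 * H + 3) ((p.1, p.2.1.1, p.2.1.2) : Plaq 4) ≤ 1 := by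
  have h := dotProduct_coeff_inv_mulVec_coeff_le_one (posDef_dirQmat H) _ (unshift_mem_plaquettesIn hp)
  rwa [shift_unshift_dirCorner] at h

/-- **One-plaquette Gaussian tail**: for a plaquette `p` touching the cold box and `R ≥ 0`, `D{R ≤ |s(p)|} ≤ 2e^{−R²/2}`. -/
theorem measureReal_boxDirichlet_abs_dirCirc_ge_le {p : ZdPlaquette 4} (hp : p ∈ plaquettesTouching (boxEdges 4 (2 * H + 1)))
    {R : ℝ} (hR : 0 ≤ R) :
    (boxDirichlet H).real {s | R ≤ |dirCirc H (p.1, p.2.1.1, p.2.1.2) s|} ≤ 2 * Real.exp (-R ^ 2 / 2) := by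
  have h := Literature.Probability.Distributions.measureReal_abs_dotProduct_ge_le (posSemidef_dirQmat_inv H)
    (coeff (fun e => e ∉ dirFreeEdges H) dirCorner (2 * H + 3) ((p.1, p.2.1.1, p.2.1.2) : Plaq 4)) (v := 1)
    (by simpa using coeff_inv_mulVec_coeff_le_one_of_touching hp) hR
  have hset : {s : EuclideanSpace ℝ (DirFree H) | R ≤ |dirCirc H (p.1, p.2.1.1, p.2.1.2) s|} =
      {s | R ≤ |∑ e : DirFree H, coeff (fun e => e ∉ dirFreeEdges H) dirCorner (2 * H + 3)
        ((p.1, p.2.1.1, p.2.1.2) : Plaq 4) e * s e|} := by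
    ext s; simp only [Set.mem_setOf_eq, dirCirc_eq_sum]
  rw [hset]
  refine h.trans (le_of_eq ?_)
  norm_num

/-- **Gaussian large fields, union bound**: for `R ≥ 0`,
`D{∃ p touching Λ_H, R ≤ |s(p)|} ≤ 2·#(plaquettesTouching Λ_H)·e^{−R²/2}` under `boxDirichlet H`. -/
theorem measureReal_boxDirichlet_exists_abs_dirCirc_ge_le (H : ℕ) {R : ℝ} (hR : 0 ≤ R) :
    (boxDirichlet H).real {s | ∃ p ∈ plaquettesTouching (boxEdges 4 (2 * H + 1)), R ≤ |dirCirc H (p.1, p.2.1.1, p.2.1.2) s|} ≤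
      2 * #(plaquettesTouching (boxEdges 4 (2 * H + 1))) * Real.exp (-R ^ 2 / 2) := by
  have h := Literature.Probability.Distributions.measureReal_exists_abs_dotProduct_ge_le (posSemidef_dirQmat_inv H)
    (plaquettesTouching (boxEdges 4 (2 * H + 1)))
    (fun p : ZdPlaquette 4 => coeff (fun e => e ∉ dirFreeEdges H) dirCorner (2 * H + 3) ((p.1, p.2.1.1, p.2.1.2) : Plaq 4))
    (v := 1) (fun p hp => by simpa using coeff_inv_mulVec_coeff_le_one_of_touching hp) hR
  have hset : {s : EuclideanSpace ℝ (DirFree H) |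
        ∃ p ∈ plaquettesTouching (boxEdges 4 (2 * H + 1)), R ≤ |dirCirc H (p.1, p.2.1.1, p.2.1.2) s|} =
      {s | ∃ p ∈ plaquettesTouching (boxEdges 4 (2 * H + 1)),
        R ≤ |∑ e : DirFree H, coeff (fun e => e ∉ dirFreeEdges H) dirCorner (2 * H + 3)
          ((p.1, p.2.1.1, p.2.1.2) : Plaq 4) e * s e|} := by
    ext s; simp only [Set.mem_setOf_eq, dirCirc_eq_sum]
  rw [hset]
  refine h.trans (le_of_eq ?_)
  norm_num

/-- **Gaussian large fields, complement form**: for `R ≥ 0` the `boxDirichlet H`-mass of the complement of the small-field region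
«every circulation of `ℤ⁴` is at most `R` in absolute value» is at most `240(2H+1)⁴e^{−R²/2}` (circulations of plaquettes not touching
the cold box vanish identically; `#(plaquettesTouching Λ_H) ≤ 120(2H+1)⁴`). -/
theorem measureReal_boxDirichlet_not_smallField_le (H : ℕ) {R : ℝ} (hR : 0 ≤ R) :
    (boxDirichlet H).real {s | ¬ ∀ p : ZdPlaquette 4, |dirCirc H (p.1, p.2.1.1, p.2.1.2) s| ≤ R} ≤
      240 * (2 * (H : ℝ) + 1) ^ 4 * Real.exp (-R ^ 2 / 2) := by
  have hsub : {s : EuclideanSpace ℝ (DirFree H) | ¬ ∀ p : ZdPlaquette 4, |dirCirc H (p.1, p.2.1.1, p.2.1.2) s| ≤ R} ⊆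
      {s | ∃ p ∈ plaquettesTouching (boxEdges 4 (2 * H + 1)), R ≤ |dirCirc H (p.1, p.2.1.1, p.2.1.2) s|} := by
    intro s hs
    simp only [Set.mem_setOf_eq, not_forall, not_le] at hs ⊢
    obtain ⟨p, hp⟩ := hs
    by_cases hmem : p ∈ plaquettesTouching (boxEdges 4 (2 * H + 1))
    · exact ⟨p, hmem, hp.le⟩
    · exfalso
      have h0 : dirCirc H (p.1, p.2.1.1, p.2.1.2) s = 0 := sCirc_dirGlue_eq_zero_of_not_touching _ hmem
      rw [h0, abs_zero] at hp
      linarith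
  have hcard : (#(plaquettesTouching (boxEdges 4 (2 * H + 1))) : ℝ) ≤ 120 * (2 * (H : ℝ) + 1) ^ 4 := by
    have h := card_plaquettesTouching_boxEdges_le (2 * H + 1)
    have : ((#(plaquettesTouching (boxEdges 4 (2 * H + 1))) : ℕ) : ℝ) ≤ ((120 * (2 * H + 1) ^ 4 : ℕ) : ℝ) := by
      exact_mod_cast h
    push_cast at this
    exact this
  calc (boxDirichlet H).real {s | ¬ ∀ p : ZdPlaquette 4, |dirCirc H (p.1, p.2.1.1, p.2.1.2) s| ≤ R}
      ≤ (boxDirichlet H).real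
          {s | ∃ p ∈ plaquettesTouching (boxEdges 4 (2 * H + 1)), R ≤ |dirCirc H (p.1, p.2.1.1, p.2.1.2) s|} :=
        measureReal_mono hsub
    _ ≤ 2 * #(plaquettesTouching (boxEdges 4 (2 * H + 1))) * Real.exp (-R ^ 2 / 2) :=
        measureReal_boxDirichlet_exists_abs_dirCirc_ge_le H hR
    _ ≤ 2 * (120 * (2 * (H : ℝ) + 1) ^ 4) * Real.exp (-R ^ 2 / 2) := by
        gcongr
    _ = 240 * (2 * (H : ℝ) + 1) ^ 4 * Real.exp (-R ^ 2 / 2) := by ring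

end Summit.QuantumFields.YangMills.Theorems.WeakCouplingRates

end
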